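import Literature.MathematicalPhysics.QuantumFieldTheory.Balaban1983to89.B9Eq326OperatorTower
import Literature.MathematicalPhysics.QuantumFieldTheory.Balaban1983to89.B9Eq324LevelWeights

/-!
# `Balaban1983to89.B9Eq326MultiLevelAssembly` — [Balaban1985BackgroundPropagators] p. 395 (3.26)–(3.27): THE OPERATOR
# `Δ_a(U) = Δ(U) + D_U R(U) D*_U + Q*(U)aQ(U)` WITH PRINT'S MULTI-LEVEL `Q*(U)aQ(U)` OF (3.16) (ALL levels `j = 0, …, k`, the composite
# averagings `Q_j(U) = Q(Ū^{j−1})⋯Q(U)` of (3.15), the level sets `Λ_j`), `R(U)` of (3.21) built IN `L²(Ω₀, 𝔤)` from the multi-level `Q′` of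
# (3.18)–(3.19) and the Dirichlet covariant Laplacian (3.23), the Dirichlet restriction `Δ_a↾Ω₀ = Ω₀Δ_aΩ₀` and ITS INVERSE `G(U) = (Δ_a↾Ω₀)⁻¹`
# (3.27) — all on ONE carrier, the tower of tori `T_{L^k m} → ⋯ → T_m` of `B9Eq315QTower` — seat r06 (B9 fold owner) gen 25, row B9.Eq3.26

statement-level skeleton of published theorems with citation tags; proofs where landed; nothing here is a claim about the Yang–Mills mass gap

CITATION HEADER (lean-in-tree rule).  T. Bałaban, *Propagators for lattice gauge theories in a background field*, Commun. Math. Phys. **99** (1985)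
389–434 [Balaban1985BackgroundPropagators] (cell paper B9; held `paper:balaban1985-cmp99-background-propagators`, journal page = PDF page + 388),
pp. 393–395 [PDF 5–7], re-read by this seat 2026-08-23 in the held text (`lit read … --pages 5-8`).  [4] = T. Bałaban, *Propagators and renormalization
transformations for lattice gauge theories. II*, Commun. Math. Phys. **96** (1984) 223–250 [Balaban1984PropagatorsII] (held `paper:balaban1984-cmp96-propagators-rt-ii`),
pp. 225–226 [PDF 3–4] ((2.14), (2.19)–(2.20)), read 2026-08-23.  [5] = [Balaban1985Averaging] (124) p. 36, (127) p. 37, (43) p. 24.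
THE PRINT (verbatim).  p. 393: «We are interested in the linear operators Q_j(U). They are compositions of j one-step averaging operators
Q_j(U) = Q(Ū^{j−1})…Q(Ū)Q(U), (3.15) where Q(V) is given by the explicit formula (124) in [5].»; «we define Λ_j = Ω_j^{(j)} ∖ Ω_{j+1}^{(j)}, j = 0, 1, …, k,
Ω_{k+1} = ∅ … We have introduced the domain Ω₀ because we will consider operators with Dirichlet boundary conditions on Ω₀ᶜ. We define an operator Q*aQ by
the quadratic form ⟨A, Q*aQA⟩ = Σ_{j=0}^{k} a Σ_{b∈Λ_j} (Lʲη)^{d−2}|(Q_j(U)A)(b)|². (3.16)»; «where Q′λ is defined on 𝔅 = ⋃_{j=0}^{k} Λ_j by the formulas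
(Q′λ)(y) = (Q′_j(U)λ)(y) for y ∈ Λ_j, (3.18)»; p. 394: «where R = R(U) is an orthogonal projection in the Hilbert space L²(Ω₀, 𝔤) onto the subspace
ℛ = Δ^η_U N(Q′), N(Q′) = {λ : Q′λ = 0}. (3.21) For an arbitrary function f ∈ L²(Ω₀, 𝔤) we have Rf = Δ^η_U λ₀, where λ₀ is a minimum of the function
λ ∈ N(Q′) → ‖f − Δ^η_U λ‖². (3.22) In the above formulas Δ^η_U is the covariant Laplace operator Δ^η_U = D^{η*}_U D^η_U … (3.23)»; «The operator Δ^η_U↾Ω₀ is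
the covariant Laplace operator with Dirichlet boundary conditions on Ω₀ᶜ. … i.e. the operator Δ′_a↾Ω₀ = Ω₀Δ′_aΩ₀. In the last expression Ω₀ denotes a
characteristic function of Ω₀ … All operators we will consider will be defined by using Dirichlet boundary conditions on Ω₀. Usually we will not mention
it, and we do not indicate this fact in our notations.»; p. 395: «Now we are ready to define one of the basic operators of this paper. It is an immediate
generalization of the operator Δ_a given by (2.19) in [4]. We define Δ_a(U) = Δ(U) + D_U R(U) D*_U + Q*(U)aQ(U), (3.26) or simply Δ_a = Δ + DRD* + Q*aQ.
It coincides with Δ_a in (2.19) if U = 1. Similarly as for the operator Δ′_a we will need Δ_a with Dirichlet boundary conditions on Ω₀ᶜ, thus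
Δ_a↾Ω₀ = Ω₀Δ_aΩ₀, and we denote its inverse again by G, or G(U), if we need to stress explicitly the dependence on the configuration U,
G(U) = G = (Δ_a↾Ω₀)⁻¹. (3.27)».  [4] p. 226: «and the operator Q is given by (QA)(b) = (Q_jA)(b) for b ∈ Λ_j, (Q₀A)(b) = A(b). (2.20)».

WHY THIS FILE (row B9.Eq3.26 of the cell's SKELETON, `typed-existing` since gen 1).  The tree carried (3.26) in finite-dimensional MODELS
(`B9Eq333Cov.lapFull`, `B9Eq386Neumann.deltaA`, `B9H163`) and, on the `L²` torus carrier of the pub-balaban NE9 chain, ASSEMBLED from the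
background with ONE averaging level (`B9Eq326OperatorAssembly.laplaceAofU`, `B9Eq315QTorus.laplaceAofBackground`) or with the TOP composite
`Q_k(U)` only (`B9Eq326OperatorTower.laplaceAk`: the small-field geometry `Ω_j = T`, `Λ_j = ∅` for `j < k`), on the WHOLE torus (no `↾Ω₀`; its
header: «(M3) NOT HERE: the Dirichlet restriction ↾Ω₀ of (3.27)»), while print's MULTI-LEVEL quadratic form (3.16) was typed with body only for
a PARAMETER averaging (`B9Eq324LevelWeights.qaq316`, b09 carrier) or as a real number on the [5] `ℤᵈ` carrier (`B9Eq316FormZd.form316`), where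
no Hessian `Δ(U)` lives (lead g13 HEAD WORD Q-B9-24-5: «the OPERATOR … is CONSUMED at (3.26) — it is housed at row B9.Eq3.26 … the
cross-carrier assembly is row 3.26's debt»).  This file pays that debt on the ONE carrier where every letter of (3.26) is an object of the
tree: the tower of tori `towerP L m n` (`n = k` the fine lattice `T_η`, `n = k − j` print's `T^{(j)}_{Lʲη}`, `n = 0` the unit torus).
WHAT IS DEFINED AND PROVED (definitions WITH BODY + theorems; 0 named fact, 0 sorry, standard axioms).
* §1 **`Qlevels k`** — print's `Q_j(U)` of (3.15) FOR ALL `j = 0, …, k` AT ONCE: a bond function on the level-`k` torus ↦ the family of its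
  averages on every level `n` (cast-free recursion on the fine level with `LinearMap.single`; general level backgrounds `Ulev` with [5] Prop. 2's
  displayed data, as `B9Eq315QTower.Qtower`): `Qlevels_self` («Q₀ = I», [4] (2.20)), `Qlevels_of_lt` («Ω_{k+1} = ∅»), **`Qlevels_succ_of_le`**
  (the recursion «Q_{j+1}(U) = Q_j(Ū)Q(U)»), **`Qlevels_zero_eq_Qtower`** (the deepest level IS the NE9 composite `Q_k(U)`), and AT PRINT'S FAMILY
  `Ū^{i}` of one background (`B9Eq315QTower.UlevOf`): **`Qlevels_UlevOf_apply`** / **`Qlevels_apply_eq_linCovIter`** — ON EVERY LEVEL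
  `(Q_j(U)A)(b) = (Lʲ)⁻¹·(linCovIter L Ũ Ã j)(b̃)`, the NE7c crew's [5] (127) composite of the periodic extensions, normalised (READING C-adv4-22;
  `j = k` is `B9Eq315QTower.QkOfU_apply_eq_linCovIter`) — so these ARE print's «Q_j(U) … given by the explicit formula (124) in [5]».
* §2 **`QprimeLevels k`** — `Q′_j(U)` of (3.18)–(3.19) for all `j` likewise (factors `B9Eq319QprimeTorus.QprimeLin`); `_self` («(Q′₀λ)(x) = λ(x)»),
  `_of_lt`, `_succ_of_le`, `_zero_eq_QprimeTower`.
* §3 «Ω₀ denotes a characteristic function of Ω₀» on the weighted `L²` spaces `B9Eq311L2Pairing.WL2` (any scalars `RCLike 𝕜`, any finite index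
  set): `L2On 𝕜 S c₀ W` (= `L²(S, 𝔤)`), **`resOn`** (`f↾S`), **`extOn`** (extension by zero = `Ω₀g`), **`chiOn = extOn ∘ resOn`** (the characteristic
  function as an operator), `resOn_extOn`, `chiOn_chiOn`, **`inner_extOn_left`** (`⟨Ω₀g, f⟩ = ⟨g, f↾Ω₀⟩`), `adjoint_extOn`/`adjoint_resOn`, `norm_extOn`
  (isometry), `inner_chiOn_right`, `chiOn_isSymmetric`.
* §4 the multiscale LETTERS on the tower — `ΛB j ⊂` bonds of `T^{(j)}` («b ∈ Λ_j»), `ΛS j ⊂` sites of `T^{(j)}` («y ∈ Λ_j»), `j : Fin (k+1)`; the index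
  types `BIdx`/`SIdx` (= `𝔅 = ⋃_j Λ_j`); the (3.16) level weight **`wtB … ⟨j, b⟩ = (Lʲη)^{(d:ℤ)−2}`** (`wtB_mul_eq_coeff316`: `a·wtB = B9Eq324LevelWeights.coeff316`;
  `wtB_pos`); **`Qstack`** = [4] (2.20)'s stacked averaging «(QA)(b) = (Q_j(U)A)(b) for b ∈ Λ_j» from `L²(T_η-bonds, η^d)` (`BondL2K`, (3.11)) to the
  level-weighted `L²(𝔅)` (`Qstack_apply`); **`norm_sq_Qstack`** (`‖QA‖² = Σ_j (Lʲη)^{d−2} Σ_{b∈Λ_j}|(Q_j(U)A)(b)|²`) and **`inner_adjoint_Qstack`** — THE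
  DISPLAY (3.16): `⟨A, Q†(aQ)A⟩ = Σ_{j=0}^{k} a Σ_{b∈Λ_j} (Lʲη)^{d−2}|(Q_j(U)A)(b)|²`, i.e. `Q†(aQ)` IS the operator «defined by the quadratic form»;
  **`QprimeStack`** = (3.18) «(Q′λ)(y) = (Q′_j(U)λ)(y) for y ∈ Λ_j» (`QprimeStack_apply`).
* §5 AT ONE BACKGROUND `U` on `T_η = T_{L^k m}` (level family `UlevOf L m k U`, transporters `R(Ū^{i}(b))` = `adTransportW φ (UlevOf … i)` as
  `B9Eq326OperatorTower.QprimeTowerW`): `bondsIn Ω₀` (the bonds of `Ω₀`, the cell's convention `B9Eq323DirichletSplit.intBonds`); **`lapDir`** =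
  «Δ^η_U with Dirichlet boundary conditions» `Ω₀ D*_U D_U Ω₀` on `L²(Ω₀, 𝔤)` ((3.23) `B11Eq103H1Complex.covLaplaceSiteK`, sandwiched); **`QprimeDir`** =
  (3.18) on `L²(Ω₀, 𝔤)`; **`Rdir`** = `R(U)` OF (3.21), «an orthogonal projection in the Hilbert space L²(Ω₀, 𝔤) onto ℛ = Δ^η_U N(Q′)»
  (`B11Eq103H1Complex.projR` at these letters; `Rdir_isSymmetric`, `Rdir_Rdir`, **`exists_ker_Rdir_eq`** = (3.22) `Rf = Δ^η_U λ₀, Q′λ₀ = 0`); **`Rtorus`**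
  = `Ω₀RΩ₀` read on `L²(T_η, 𝔤)` (`Rtorus_isSymmetric`); **`QaQ a`** = `Q*(U)aQ(U)` := `Q†(aQ)` at print's composites with **`inner_QaQ`** = (3.16) verbatim;
  **`laplaceA a`** = (3.26) `Δ_a(U) = Δ(U) + D_U R(U) D*_U + Q*(U)aQ(U)` := `B11Eq103H1Complex.laplaceALatticeK` at `Δ₁ := hessOp φ η U τ` ((3.10)
  `B9Eq310HessianOperator`), `Rr := Rtorus`, `Q := Qstack`, `a`; **`laplaceA_eq`** («or simply Δ_a = Δ + DRD* + Q*aQ», by `rfl`); **`laplaceA_isSymmetric`**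
  (unitary `U`, `*`-trace `τ`, compatibility of the two normings [B7] (18) — the mechanism of `B9Eq326OperatorTower.laplaceAk_isSymmetric`);
  **`laplaceADir a`** = `Δ_a↾Ω₀ := Ω₀Δ_aΩ₀` on `L²` of the bonds of `Ω₀`, **`extOn_laplaceADir_resOn`** (it IS the sandwich `χ_{Ω₀} Δ_a χ_{Ω₀}` on `L²(T_η, 𝔤)`,
  by `rfl`), `laplaceADir_isSymmetric`; **`G hpos`** = (3.27) `G(U) = (Δ_a↾Ω₀)⁻¹` CONSTRUCTED (`B11Eq103H1Complex.greenK`) from the positivity of `Δ_a↾Ω₀`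
  (Theorem 3.11 p. 416 «Δ_a, G are positive definite» — DISPLAYED as `hpos`, not proved), **`laplaceADir_G`**, **`G_laplaceADir`** (two-sided inverse),
  `G_isSymmetric`; **`Gtorus`** = `Ω₀GΩ₀` with **`Gtorus_comp_dirichlet`** / **`dirichlet_comp_Gtorus`**: `(Ω₀GΩ₀)(Ω₀Δ_aΩ₀) = Ω₀ = (Ω₀Δ_aΩ₀)(Ω₀GΩ₀)`.
MODEL / DECLARED READINGS.  (M1) Carrier = the NE9 tower of tori (`B9Eq315QTower`: `towerP L m n = L^n·m`, `n = k` the fine lattice) with the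
`L²` spaces of `B9Eq311L2Pairing`/`B11Eq103H1Complex` (fibre `W ≅ 𝔤ᶜ ⊂ 𝔸` read along `φ : W ≃ₗ[ℂ] 𝔸`, uniform weight `c₀` = `η^d` of (3.11), scalar `η⁻¹`
in `D`/`D*`, transporters `R(U(b))`/`R(U(b)⁻¹)` on the fibre), exactly as rows B9.Eq3.10/3.15/3.19/3.23 and the NE9 one-level files.  (M2) `Λ_j`
(bonds / sites of `T^{(j)}`) and `Ω₀ ⊂ T_η` are LETTERS (finite sets), as in rows B9.Eq3.16/3.18/3.24: the cube geometry Ω_j ⊃ B(Ω_{j+1}), [4]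
(2.1)–(2.4), «Ω₀ is a union of big blocks» is not modelled; «b ∈ Λ_j» / the bonds of `Ω₀` = bonds with both endpoints in the set (`bondsIn`).  (M3)
`Q*` = the Hilbert adjoint `Q†` for the level-weighted `L²(𝔅)` (weight `(Lʲη)^{d−2}`, the factor `a` as the scalar of `laplaceALatticeK`): the
OPERATOR `Q†(aQ)` is print's `Q*aQ` by its defining identity (3.16) (`inner_QaQ`), whatever normalisation of the `𝔅`-pairing one prefers.  (M4)
The level backgrounds `Ū^{i}` carry [5] Prop. 2's displayed data (`hU1`, `hreg`, `α_i ≦ 1/64`; print p. 395 «Assuming some regularity of the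
configuration U») at every level index, as `B9Eq315QTower.QkOfU`/`B9Eq326OperatorTower.QkW`.  (M5) `d − 2` is an integer exponent; `η > 0`
(`Fact (0 < η)`) makes `L²(𝔅)` an inner-product space.  (M6) DISPLAYED, never asserted: the positivity of `Δ_a↾Ω₀` (Theorem 3.11 = row B9.Thm3.11,
`hpos` of `G`); unitarity/trace hypotheses of the symmetry statements.
HONEST SCOPE.  Definitions with bodies at printed formulas + kernel-checked bookkeeping (linearity, adjoints, the identity (3.16), the (3.22)
shape, two-sided inversion); NO inequality of the paper; not the identification of this `Δ_a` at `U = 1` with [4] (2.19) («It coincides with Δ_a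
in (2.19) if U = 1» — the flat dictionary is `B9Eq326OperatorTowerFlat`'s business at one level; not re-derived here); not the identification
`laplaceA = B9Eq326OperatorTower.laplaceAk` in the small-field geometry (`Ω₀ = T_η`, `Λ_j = ∅` for `j < k`; by inspection of the letters, not
typed); `H₁`, `𝔊`, (3.25) for `R` are other rows (B9.Eq3.25/3.126/3.153).  NOT summit progress (cell pub-balaban: NE9 NOT PRINTED / NOT PROVED).
RELATED IN THE TREE, NOT DUPLICATED (searched 2026-08-23, `lean search --decl 'Qlevels|QprimeLevels|laplaceADir|Qstack|extOn|resOn'`, and the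
row-3.26 members: `B9Eq326OperatorAssembly.laplaceAofU`, `B9Eq326OperatorSymmetric`, `B9Eq315QTorus.laplaceAofBackground`, `B9Eq315QTorusOnto`,
`B9Eq326OperatorTower.laplaceAk`/`RofUk`/`QkW` (one level / top composite, whole torus), `B9Eq324LevelWeights.qaq316`/`form316` (parameter `Q`, b09
carrier), `B9Eq316FormZd.form316` ([5] carrier, real-valued), `B9Eq323DirichletSplit.resS/extS/intBonds` and `B9Eq321DirichletIndependence` (Dirichlet
dictionary on the `PiLp` carriers over `ℝ`), `B9Eq316TowerFlatIsOneStep.bondL2Cast` (casts along period identities — not needed here: the level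
recursion of §1 is cast-free).  New file; imports `B9Eq326OperatorTower` (hence `B9Eq315QTower`, `B11Eq103H1Complex`, `B9Eq310HessianOperator`) and
`B9Eq324LevelWeights` (`coeff316`); nothing modified.  Net new unproved facts: 0.
VERSIONS.  v1.0 = p368667 (§§1–5).  v1.1 (r06 g25, append-only; §§1–5 byte-identical): §6 — the quadratic form of (3.26) term by term
(`inner_Rdir_self`, **`inner_DRD`** = the gauge-fixing term is the exponent ‖RD*A‖² of (3.20), `inner_QaQ_eq_norm_sq`, **`inner_laplaceA`** /
`re_inner_laplaceA`: ⟨A, Δ_aA⟩ = ⟨A, Δ(U)A⟩ + ‖R((D*_UA)↾Ω₀)‖² + a‖Q(U)A‖²) and the uniqueness of «its inverse» G (`eq_G_of_rightInverse`, `eq_G_of_leftInverse`).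
-/

noncomputable section

open scoped InnerProductSpace ComplexConjugate BigOperators

namespace Literature.MathematicalPhysics.QuantumFieldTheory.Balaban1983to89.B9Eq326MultiLevelAssembly

open B4Sect5Torus (TSite)
open B9SectCLatticeCarrier (Bond bpos btgt)
open B7Prop1Explicit (U1 Wcx boxVec)
open B7Prop2Explicit (avgIter avgIter_zero)
open B7Prop3GeneralLinear (linQcov)
open B7Prop4GeneralLevels (linCovIter linCovIter_zero)
open B9Eq311L2Pairing (WL2)
open B11Eq103H1Complex (SiteL2K BondL2K covLaplaceSiteK projR projR_isSymmetric exists_ker_projR_eq projR_projR laplaceALatticeK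
  laplaceALatticeK_isSymmetric greenK apply_greenK greenK_apply)
open B9Eq310HessianOperator (adTransportW hessOp)
open B9Eq310HessianHermitian (adTransportW_adjoint hessOp_isSymmetric_of_trace)
open B9Eq319QprimeTorus (fineP QprimeLin)
open B9Eq315QTorus (perCfg perCfg_apply cornerSite QtorusLin QtorusLin_apply)
open B9Eq315QTorusOnto (liftSite perSite_liftSite)
open B9Eq315QTower (towerP towerP_zero towerP_succ UlevOf Qtower Qtower_zero Qtower_succ QkOfU QprimeTower QprimeTower_zero
  QprimeTower_succ perCfg_UlevOf perCfg_QtorusLin avgIter_add linCovIter_add)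
open B9Eq324LevelWeights (coeff316)
open LatticeNorms (scaleLen scaleLen_pos)

variable {d : ℕ}

/-! ## §1 Print's composites `Q_j(U) = Q(Ū^{j−1})⋯Q(Ū)Q(U)` of (3.15) FOR ALL `j` AT ONCE on the tower of tori -/

section Levels

variable {𝔸 : Type*} [NormedRing 𝔸] [NormedAlgebra ℂ 𝔸] [CompleteSpace 𝔸] [NormOneClass 𝔸]
  (L : ℕ) [NeZero L] (m : Fin d → ℕ) [∀ i, NeZero (m i)] (hL : 1 ≤ L)
  (Ulev : (n : ℕ) → Bond d (towerP L m (n + 1)) → 𝔸ˣ) (α : ℕ → ℝ) (hα1 : ∀ n, α n ≤ 1 / 64)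
  (hU1 : ∀ (n : ℕ) (x : B7Prop1Explicit.Site d) (κ : Fin d), perCfg (towerP L m (n + 1)) (Ulev n) x κ ∈ U1 𝔸)
  (hreg : ∀ (n : ℕ) (y : TSite d (towerP L m n)) (κ : Fin d) (r : Fin d → Fin L),
    ‖((Wcx L (perCfg (towerP L m (n + 1)) (Ulev n)) (cornerSite L y) κ (boxVec L r) : 𝔸ˣ) : 𝔸) - 1‖ ≤ α n)

/-- **THE AVERAGED FIELD ON EVERY LEVEL OF THE TOWER**: for a bond function `A` on the level-`k` torus `T_{L^k m}` (the fine lattice `T_η`),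
`Qlevels k A n` is `A` averaged down to the level-`n` torus `T_{L^n m}` (print's lattice `T^{(j)}_{Lʲη}`, `j = k − n`) by the composite
`Q_{k−n} = Q(U_n)⋯Q(U_{k−1})` of one-step factors `B9Eq315QTorus.QtorusLin` at the level backgrounds — print's «Q_j(U) = Q(Ū^{j−1})…Q(Ū)Q(U)»
for ALL `j = 0, …, k` as ONE linear map (`Qlevels k A k = A`: `Q₀ = I`; levels `n > k` carry `0`).  Defined by the recursion of (3.15) on the
fine level: `Qlevels 0 = ι₀`, `Qlevels (k+1) = ι_{k+1} + Qlevels k ∘ Q(U_k)` (`ι_n` = the inclusion of the level-`n` functions).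
[cite: Balaban1985BackgroundPropagators, (3.15) p.393; Balaban1984PropagatorsII, (2.20) p.226] -/
def Qlevels : (k : ℕ) → ((Bond d (towerP L m k) → 𝔸) →ₗ[ℂ] ((n : ℕ) → Bond d (towerP L m n) → 𝔸))
  | 0 => LinearMap.single ℂ (fun n => Bond d (towerP L m n) → 𝔸) 0
  | k + 1 => LinearMap.single ℂ (fun n => Bond d (towerP L m n) → 𝔸) (k + 1) +
      ((Qlevels k).comp (QtorusLin L (towerP L m k) hL (Ulev k) (hα1 k) (hU1 k) (hreg k)) :
        (Bond d (towerP L m (k + 1)) → 𝔸) →ₗ[ℂ] ((n : ℕ) → Bond d (towerP L m n) → 𝔸))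

/-- Above the fine lattice there is nothing: `Qlevels k A n = 0` for `n > k` («Ω_{k+1} = ∅»). [cite: Balaban1985BackgroundPropagators, (3.15)–(3.16) p.393] -/
theorem Qlevels_of_lt : ∀ {k n : ℕ}, k < n → ∀ A : Bond d (towerP L m k) → 𝔸, Qlevels L m hL Ulev α hα1 hU1 hreg k A n = 0
  | 0, n, hn, A => by
    show (Pi.single (M := fun n => Bond d (towerP L m n) → 𝔸) 0 A) n = 0
    exact Pi.single_eq_of_ne hn.ne' _
  | k + 1, n, hn, A => by
    show (Pi.single (M := fun n => Bond d (towerP L m n) → 𝔸) (k + 1) A) n +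
        Qlevels L m hL Ulev α hα1 hU1 hreg k (QtorusLin L (towerP L m k) hL (Ulev k) (hα1 k) (hU1 k) (hreg k) A) n = 0
    rw [Pi.single_eq_of_ne hn.ne', Qlevels_of_lt (Nat.lt_of_succ_lt hn), add_zero]

/-- **`Q₀(U) = I`**: on the fine lattice itself the field is not averaged («(Q₀A)(b) = A(b)», [4] (2.20)).
[cite: Balaban1985BackgroundPropagators, (3.15) p.393; Balaban1984PropagatorsII, (2.20) p.226] -/
theorem Qlevels_self : ∀ (k : ℕ) (A : Bond d (towerP L m k) → 𝔸), Qlevels L m hL Ulev α hα1 hU1 hreg k A k = A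
  | 0, A => by
    show (Pi.single (M := fun n => Bond d (towerP L m n) → 𝔸) 0 A) 0 = A
    exact Pi.single_eq_same _ _
  | k + 1, A => by
    show (Pi.single (M := fun n => Bond d (towerP L m n) → 𝔸) (k + 1) A) (k + 1) +
        Qlevels L m hL Ulev α hα1 hU1 hreg k (QtorusLin L (towerP L m k) hL (Ulev k) (hα1 k) (hU1 k) (hreg k) A) (k + 1) = A
    rw [Pi.single_eq_same, Qlevels_of_lt L m hL Ulev α hα1 hU1 hreg (Nat.lt_succ_self k), add_zero]

/-- **The recursion of (3.15), «Q_{j+1}(U) = Q_j(Ū)Q(U)»**: averaging from the finer lattice `T_{L^{k+1} m}` down to level `n ≤ k` is the one-step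
factor `Q(U_k)` followed by the averaging from `T_{L^k m}`. [cite: Balaban1985BackgroundPropagators, (3.15) p.393] -/
theorem Qlevels_succ_of_le {k n : ℕ} (hn : n ≤ k) (A : Bond d (towerP L m (k + 1)) → 𝔸) :
    Qlevels L m hL Ulev α hα1 hU1 hreg (k + 1) A n =
      Qlevels L m hL Ulev α hα1 hU1 hreg k (QtorusLin L (towerP L m k) hL (Ulev k) (hα1 k) (hU1 k) (hreg k) A) n := by
  show (Pi.single (M := fun n => Bond d (towerP L m n) → 𝔸) (k + 1) A) n + _ = _
  rw [Pi.single_eq_of_ne (Nat.lt_succ_of_le hn).ne, zero_add]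
  rfl

/-- **The deepest level is the NE9 composite**: `Qlevels k A 0 = B9Eq315QTower.Qtower k A` (`Q_k(U)` down to the unit torus `T_m`).
[cite: Balaban1985BackgroundPropagators, (3.15) p.393] -/
theorem Qlevels_zero_eq_Qtower : ∀ (k : ℕ) (A : Bond d (towerP L m k) → 𝔸),
    Qlevels L m hL Ulev α hα1 hU1 hreg k A 0 = Qtower L m hL Ulev α hα1 hU1 hreg k A
  | 0, A => by rw [Qlevels_self]; rfl
  | k + 1, A => by rw [Qlevels_succ_of_le L m hL Ulev α hα1 hU1 hreg (Nat.zero_le k), Qlevels_zero_eq_Qtower k]; rfl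

end Levels

/-! ### Print's family `Ū^j` from ONE background: `Q_j(U)` on every level IS the periodic reading of [5] (127) -/

section OneBackground

variable {𝔸 : Type*} [NormedRing 𝔸] [NormedAlgebra ℂ 𝔸] [CompleteSpace 𝔸] [NormOneClass 𝔸]
  (L : ℕ) [NeZero L] (m : Fin d → ℕ) [∀ i, NeZero (m i)] (hL : 1 ≤ L) (K : ℕ) (U : Bond d (towerP L m K) → 𝔸ˣ)
  (α : ℕ → ℝ) (hα1 : ∀ n, α n ≤ 1 / 64)
  (hU1 : ∀ (n : ℕ) (x : B7Prop1Explicit.Site d) (κ : Fin d), perCfg (towerP L m (n + 1)) (UlevOf L m K U n) x κ ∈ U1 𝔸)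
  (hreg : ∀ (n : ℕ) (y : TSite d (towerP L m n)) (κ : Fin d) (r : Fin d → Fin L),
    ‖((Wcx L (perCfg (towerP L m (n + 1)) (UlevOf L m K U n)) (cornerSite L y) κ (boxVec L r) : 𝔸ˣ) : 𝔸) - 1‖ ≤ α n)

/-- **`Q_j(U)` at print's averaged backgrounds `Ū^{i}` ([5] (43)) read on `ℤ^d`**: for the family `UlevOf L m K U` of one background `U` on the
level-`K` torus and a field `A` on level `n + j ≤ K`, the `j`-fold averaging down to level `n` is `(Lʲ)⁻¹ ·` the NE7c composite (127)
`linCovIter` at the background `Ū^{K−(n+j)}`, read periodically (the intermediate-level form of `B9Eq315QTower.Qtower_UlevOf_apply`).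
[cite: Balaban1985BackgroundPropagators, (3.15) p.393; Balaban1985Averaging, (127) p.37, (43) p.24] -/
theorem Qlevels_UlevOf_apply (n : ℕ) : ∀ {j : ℕ}, n + j ≤ K →
    ∀ (A : Bond d (towerP L m (n + j)) → 𝔸) (b : Bond d (towerP L m n)),
    Qlevels L m hL (UlevOf L m K U) α hα1 hU1 hreg (n + j) A n b =
      (((L : ℂ) ^ j))⁻¹ • linCovIter L (avgIter L (perCfg (towerP L m K) U) (K - (n + j)))
        (perCfg (towerP L m (n + j)) A) j (liftSite b.1) b.2
  | 0, _, A, b => by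
    obtain ⟨y, κ⟩ := b
    simp only [pow_zero, inv_one, one_smul, linCovIter_zero, perCfg_apply, perSite_liftSite]
    exact congrFun (Qlevels_self L m hL (UlevOf L m K U) α hα1 hU1 hreg n A) (y, κ)
  | j + 1, hj, A, b => by
    show Qlevels L m hL (UlevOf L m K U) α hα1 hU1 hreg (n + j + 1) A n b =
      (((L : ℂ) ^ (j + 1)))⁻¹ • linCovIter L (avgIter L (perCfg (towerP L m K) U) (K - (n + j + 1)))
        (perCfg (towerP L m (n + j + 1)) A) (j + 1) (liftSite b.1) b.2
    set V := perCfg (towerP L m (n + j + 1)) (UlevOf L m K U (n + j)) with hV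
    set At := perCfg (towerP L m (n + j + 1)) A with hAt
    -- the one-step output, un-normalised
    set X : Bond d (towerP L m (n + j)) → 𝔸 := fun b => linQcov L V At (cornerSite L b.1) b.2 with hX
    have hQA : QtorusLin L (towerP L m (n + j)) hL (UlevOf L m K U (n + j)) (hα1 (n + j)) (hU1 (n + j)) (hreg (n + j)) A =
        ((L : ℂ))⁻¹ • X := by
      funext b; rw [Pi.smul_apply, QtorusLin_apply]; rfl
    have hXper : perCfg (towerP L m (n + j)) X = linCovIter L V At 1 := by
      funext z κ'
      have h := perCfg_QtorusLin (towerP L m (n + j)) L hL (UlevOf L m K U (n + j)) (hα1 (n + j)) (hU1 (n + j)) (hreg (n + j)) A z κ'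
      rw [hQA] at h
      have h' : perCfg (towerP L m (n + j)) (((L : ℂ))⁻¹ • X) z κ' = ((L : ℂ))⁻¹ • perCfg (towerP L m (n + j)) X z κ' := rfl
      rw [h'] at h
      have hL0 : ((L : ℂ))⁻¹ ≠ 0 := inv_ne_zero (by exact_mod_cast (NeZero.ne L))
      rw [show linCovIter L V At 1 z κ' = linQcov L V At ((L : ℤ) • z) κ' from rfl]
      exact smul_right_injective _ hL0 h
    have hstep : Qlevels L m hL (UlevOf L m K U) α hα1 hU1 hreg (n + j + 1) A n b =
        ((L : ℂ))⁻¹ • Qlevels L m hL (UlevOf L m K U) α hα1 hU1 hreg (n + j) X n b := by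
      rw [Qlevels_succ_of_le L m hL (UlevOf L m K U) α hα1 hU1 hreg (Nat.le_add_right n j), hQA, map_smul]
      rfl
    rw [hstep, Qlevels_UlevOf_apply n (Nat.le_of_succ_le hj) X b, hXper, hV, perCfg_UlevOf L m (show n + j + 1 ≤ K from hj),
      show K - (n + j) = K - 1 - (n + j) + 1 by omega, avgIter_add, ← linCovIter_add, smul_smul, ← mul_inv, ← pow_succ',
      add_comm 1 j, show K - (n + j + 1) = K - 1 - (n + j) by omega]

end OneBackground

section OneBackgroundTop

variable {𝔸 : Type*} [NormedRing 𝔸] [NormedAlgebra ℂ 𝔸] [CompleteSpace 𝔸] [NormOneClass 𝔸]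
  (L : ℕ) [NeZero L] (m : Fin d → ℕ) [∀ i, NeZero (m i)] (hL : 1 ≤ L) (n j : ℕ) (U : Bond d (towerP L m (n + j)) → 𝔸ˣ)
  (α : ℕ → ℝ) (hα1 : ∀ i, α i ≤ 1 / 64)
  (hU1 : ∀ (i : ℕ) (x : B7Prop1Explicit.Site d) (κ : Fin d), perCfg (towerP L m (i + 1)) (UlevOf L m (n + j) U i) x κ ∈ U1 𝔸)
  (hreg : ∀ (i : ℕ) (y : TSite d (towerP L m i)) (κ : Fin d) (r : Fin d → Fin L),
    ‖((Wcx L (perCfg (towerP L m (i + 1)) (UlevOf L m (n + j) U i)) (cornerSite L y) κ (boxVec L r) : 𝔸ˣ) : 𝔸) - 1‖ ≤ α i)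

/-- **`Q_j(U)` OF (3.15) «given by the explicit formula (124) in [5]» — ON EVERY LEVEL**: for ONE background `U` on the fine torus (level `n + j`)
and its averaged family `Ū^{i}`, the `j`-fold composite down to level `n` is `(Q_j(U)A)(b) = (Lʲ)⁻¹ · (linCovIter L Ũ Ã j)(b̃)` — the NE7c crew's
(127) composite of the periodic extensions, normalised (READING C-adv4-22); `j = k` is `B9Eq315QTower.QkOfU_apply_eq_linCovIter`.
[cite: Balaban1985BackgroundPropagators, (3.15) p.393; Balaban1985Averaging, (124) p.36, (127) p.37] -/
theorem Qlevels_apply_eq_linCovIter (A : Bond d (towerP L m (n + j)) → 𝔸) (b : Bond d (towerP L m n)) :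
    Qlevels L m hL (UlevOf L m (n + j) U) α hα1 hU1 hreg (n + j) A n b =
      (((L : ℂ) ^ j))⁻¹ • linCovIter L (perCfg (towerP L m (n + j)) U) (perCfg (towerP L m (n + j)) A) j (liftSite b.1) b.2 := by
  rw [Qlevels_UlevOf_apply L m hL (n + j) U α hα1 hU1 hreg n le_rfl A b, Nat.sub_self, avgIter_zero]

end OneBackgroundTop

/-! ## §2 The gauge-parameter composites `Q′_j(U)` of (3.18)–(3.19) for all `j` at once -/

section QprimeLevels

variable {V : Type*} [AddCommGroup V] [Module ℂ V] (L : ℕ) [NeZero L] (m : Fin d → ℕ)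
  (Rlev : (n : ℕ) → Bond d (towerP L m (n + 1)) → V →ₗ[ℂ] V)

/-- **THE AVERAGED GAUGE PARAMETER ON EVERY LEVEL**: `QprimeLevels k l n` = `Q′_{k−n} l` read on the level-`n` torus, the composite of the
one-step factors `B9Eq319QprimeTorus.QprimeLin` ((3.19): `Σ_{x∈B(y)} L^{−d} R(U(Γ_{y,x}))λ(x)`) at the level transporter data `Rlev`; `Q′₀ = I`
(«(Q′₀λ)(x) = λ(x), x ∈ Λ₀», [4] p. 225); levels `n > k` carry `0`. [cite: Balaban1985BackgroundPropagators, (3.18)–(3.19) p.393; Balaban1984PropagatorsII, (2.14) p.225] -/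
def QprimeLevels : (k : ℕ) → ((TSite d (towerP L m k) → V) →ₗ[ℂ] ((n : ℕ) → TSite d (towerP L m n) → V))
  | 0 => LinearMap.single ℂ (fun n => TSite d (towerP L m n) → V) 0
  | k + 1 => LinearMap.single ℂ (fun n => TSite d (towerP L m n) → V) (k + 1) +
      ((QprimeLevels k).comp (QprimeLin L (towerP L m k) (Rlev k)) :
        (TSite d (towerP L m (k + 1)) → V) →ₗ[ℂ] ((n : ℕ) → TSite d (towerP L m n) → V))

/-- `QprimeLevels k l n = 0` for `n > k`. [cite: Balaban1985BackgroundPropagators, (3.18) p.393] -/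
theorem QprimeLevels_of_lt : ∀ {k n : ℕ}, k < n → ∀ l : TSite d (towerP L m k) → V, QprimeLevels L m Rlev k l n = 0
  | 0, n, hn, l => by
    show (Pi.single (M := fun n => TSite d (towerP L m n) → V) 0 l) n = 0
    exact Pi.single_eq_of_ne hn.ne' _
  | k + 1, n, hn, l => by
    show (Pi.single (M := fun n => TSite d (towerP L m n) → V) (k + 1) l) n +
        QprimeLevels L m Rlev k (QprimeLin L (towerP L m k) (Rlev k) l) n = 0
    rw [Pi.single_eq_of_ne hn.ne', QprimeLevels_of_lt (Nat.lt_of_succ_lt hn), add_zero]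

/-- **`Q′₀ = I`** («(Q′₀λ)(x) = λ(x)»). [cite: Balaban1985BackgroundPropagators, (3.18) p.393; Balaban1984PropagatorsII, p.225] -/
theorem QprimeLevels_self : ∀ (k : ℕ) (l : TSite d (towerP L m k) → V), QprimeLevels L m Rlev k l k = l
  | 0, l => by
    show (Pi.single (M := fun n => TSite d (towerP L m n) → V) 0 l) 0 = l
    exact Pi.single_eq_same _ _
  | k + 1, l => by
    show (Pi.single (M := fun n => TSite d (towerP L m n) → V) (k + 1) l) (k + 1) +
        QprimeLevels L m Rlev k (QprimeLin L (towerP L m k) (Rlev k) l) (k + 1) = l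
    rw [Pi.single_eq_same, QprimeLevels_of_lt L m Rlev (Nat.lt_succ_self k), add_zero]

/-- **«Q′_{j+1}(U) = Q′_j(Ū)Q′(U)»**: one more level = the one-step factor first. [cite: Balaban1985BackgroundPropagators, (3.19) p.393] -/
theorem QprimeLevels_succ_of_le {k n : ℕ} (hn : n ≤ k) (l : TSite d (towerP L m (k + 1)) → V) :
    QprimeLevels L m Rlev (k + 1) l n = QprimeLevels L m Rlev k (QprimeLin L (towerP L m k) (Rlev k) l) n := by
  show (Pi.single (M := fun n => TSite d (towerP L m n) → V) (k + 1) l) n + _ = _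
  rw [Pi.single_eq_of_ne (Nat.lt_succ_of_le hn).ne, zero_add]
  rfl

/-- The deepest level is the NE9 composite `B9Eq315QTower.QprimeTower k` (`Q′_k` onto the unit torus).
[cite: Balaban1985BackgroundPropagators, (3.19) p.393] -/
theorem QprimeLevels_zero_eq_QprimeTower : ∀ (k : ℕ) (l : TSite d (towerP L m k) → V),
    QprimeLevels L m Rlev k l 0 = QprimeTower L m Rlev k l
  | 0, l => by rw [QprimeLevels_self]; rfl
  | k + 1, l => by rw [QprimeLevels_succ_of_le L m Rlev (Nat.zero_le k), QprimeLevels_zero_eq_QprimeTower k]; rfl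

end QprimeLevels

/-! ## §3 «Ω₀ denotes a characteristic function of Ω₀»: restriction to a finite set and extension by zero on the weighted `L²` spaces -/

section Restrict

variable (𝕜 : Type*) [RCLike 𝕜] {ι : Type*} {W : Type*} [NormedAddCommGroup W] [InnerProductSpace 𝕜 W] {c₀ : ℝ} (S : Finset ι)

/-- **`L²(S, 𝔤)`**: the `W`-valued functions on the finite set `S` with the uniform weight `c₀` (print's `L²(Ω₀, 𝔤)`, p. 393: «in the Hilbert space
L²(Ω₀, 𝔤)»). [cite: Balaban1985BackgroundPropagators, p.393, (3.21) p.394] -/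
abbrev L2On (c₀ : ℝ) (W : Type*) : Type _ := WL2 𝕜 (fun _ : ↥S => c₀) W

/-- **`f↾S`** — restriction of a function on the lattice to `S`. [cite: Balaban1985BackgroundPropagators, (3.23)–(3.24) p.394] -/
def resOn : WL2 𝕜 (fun _ : ι => c₀) W →ₗ[𝕜] L2On 𝕜 S c₀ W where
  toFun f := (WL2.equiv 𝕜 _ W).symm fun x => WL2.equiv 𝕜 _ W f (x : ι)
  map_add' _ _ := rfl
  map_smul' _ _ := rfl

/-- Values of the restriction. [cite: Balaban1985BackgroundPropagators, (3.23) p.394] -/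
@[simp] theorem resOn_apply (f : WL2 𝕜 (fun _ : ι => c₀) W) (x : ↥S) :
    WL2.equiv 𝕜 _ W (resOn 𝕜 S f) x = WL2.equiv 𝕜 _ W f (x : ι) := rfl

variable [DecidableEq ι]

/-- **`Sg` — «Ω₀ denotes a characteristic function of Ω₀»**: extension of a function on `S` by zero to the whole lattice.
[cite: Balaban1985BackgroundPropagators, p.394 (after (3.24)), (3.27) p.395] -/
def extOn : L2On 𝕜 S c₀ W →ₗ[𝕜] WL2 𝕜 (fun _ : ι => c₀) W where
  toFun g := (WL2.equiv 𝕜 _ W).symm fun i => if h : i ∈ S then WL2.equiv 𝕜 _ W g ⟨i, h⟩ else 0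
  map_add' f g := by
    funext i
    show (if h : i ∈ S then WL2.equiv 𝕜 _ W (f + g) ⟨i, h⟩ else 0) =
      (if h : i ∈ S then WL2.equiv 𝕜 _ W f ⟨i, h⟩ else 0) + (if h : i ∈ S then WL2.equiv 𝕜 _ W g ⟨i, h⟩ else 0)
    split_ifs with h
    · rfl
    · rw [add_zero]
  map_smul' r f := by
    funext i
    show (if h : i ∈ S then WL2.equiv 𝕜 _ W (r • f) ⟨i, h⟩ else 0) = r • (if h : i ∈ S then WL2.equiv 𝕜 _ W f ⟨i, h⟩ else 0)
    split_ifs with h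
    · rfl
    · rw [smul_zero]

/-- Values of the extension by zero. [cite: Balaban1985BackgroundPropagators, p.394] -/
theorem extOn_apply (g : L2On 𝕜 S c₀ W) (i : ι) :
    WL2.equiv 𝕜 _ W (extOn 𝕜 S g) i = if h : i ∈ S then WL2.equiv 𝕜 _ W g ⟨i, h⟩ else 0 := rfl

/-- `Sg = g` on `S`. [cite: Balaban1985BackgroundPropagators, p.394] -/
@[simp] theorem extOn_apply_coe (g : L2On 𝕜 S c₀ W) (x : ↥S) : WL2.equiv 𝕜 _ W (extOn 𝕜 S g) (x : ι) = WL2.equiv 𝕜 _ W g x := by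
  rw [extOn_apply, dif_pos x.2]

/-- `Sg = 0` off `S`. [cite: Balaban1985BackgroundPropagators, p.394] -/
theorem extOn_apply_of_not_mem (g : L2On 𝕜 S c₀ W) {i : ι} (hi : i ∉ S) : WL2.equiv 𝕜 _ W (extOn 𝕜 S g) i = 0 := by
  rw [extOn_apply, dif_neg hi]

/-- `(Sg)↾S = g`. [cite: Balaban1985BackgroundPropagators, p.394] -/
@[simp] theorem resOn_extOn (g : L2On 𝕜 S c₀ W) : resOn 𝕜 S (extOn 𝕜 S g) = g := by
  funext x
  exact extOn_apply_coe 𝕜 S g x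

/-- **The characteristic function `Ω₀` as an operator on `L²(T, 𝔤)`**: `f ↦ Ω₀f = S(f↾S)`. [cite: Balaban1985BackgroundPropagators, p.394, (3.27) p.395] -/
def chiOn : WL2 𝕜 (fun _ : ι => c₀) W →ₗ[𝕜] WL2 𝕜 (fun _ : ι => c₀) W := extOn 𝕜 S ∘ₗ resOn 𝕜 S

/-- Values of `Ω₀f`. [cite: Balaban1985BackgroundPropagators, p.394] -/
theorem chiOn_apply (f : WL2 𝕜 (fun _ : ι => c₀) W) (i : ι) :
    WL2.equiv 𝕜 _ W (chiOn 𝕜 S f) i = if i ∈ S then WL2.equiv 𝕜 _ W f i else 0 := by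
  rw [chiOn, LinearMap.comp_apply, extOn_apply]
  split_ifs <;> rfl

/-- `Ω₀² = Ω₀`. [cite: Balaban1985BackgroundPropagators, p.394] -/
theorem chiOn_chiOn (f : WL2 𝕜 (fun _ : ι => c₀) W) : chiOn 𝕜 S (chiOn 𝕜 S f) = chiOn 𝕜 S f := by
  rw [chiOn, LinearMap.comp_apply, LinearMap.comp_apply, resOn_extOn]

variable [Fintype ι] [Fact (0 < c₀)]

/-- **Extension by zero and restriction are mutually adjoint**: `⟨Sg, f⟩_{L²(T)} = ⟨g, f↾S⟩_{L²(S)}`. [cite: Balaban1985BackgroundPropagators, p.391, p.394] -/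
theorem inner_extOn_left (g : L2On 𝕜 S c₀ W) (f : WL2 𝕜 (fun _ : ι => c₀) W) :
    ⟪extOn 𝕜 S g, f⟫_𝕜 = ⟪g, resOn 𝕜 S f⟫_𝕜 := by
  rw [WL2.inner_def, WL2.inner_def]
  have key : ∑ i, (c₀ : 𝕜) * ⟪WL2.equiv 𝕜 _ W (extOn 𝕜 S g) i, WL2.equiv 𝕜 _ W f i⟫_𝕜 =
      ∑ i ∈ S, (c₀ : 𝕜) * ⟪WL2.equiv 𝕜 _ W (extOn 𝕜 S g) i, WL2.equiv 𝕜 _ W f i⟫_𝕜 := by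
    symm
    refine Finset.sum_subset (Finset.subset_univ S) fun i _ hi => ?_
    rw [extOn_apply_of_not_mem 𝕜 S g hi, inner_zero_left, mul_zero]
  rw [key, ← Finset.sum_attach]
  refine Finset.sum_congr (Finset.univ_eq_attach S).symm fun x _ => ?_
  rw [resOn_apply, extOn_apply_coe]

/-- `resOn = extOn†` (the Hilbert adjoint of the extension by zero is the restriction). [cite: Balaban1985BackgroundPropagators, p.391, p.394] -/
theorem adjoint_extOn [FiniteDimensional 𝕜 W] : LinearMap.adjoint (extOn 𝕜 S (c₀ := c₀) (W := W)) = resOn 𝕜 S := by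
  symm
  rw [LinearMap.eq_adjoint_iff]
  intro f g
  rw [← inner_conj_symm, ← inner_extOn_left, inner_conj_symm]

/-- `extOn = resOn†`. [cite: Balaban1985BackgroundPropagators, p.391, p.394] -/
theorem adjoint_resOn [FiniteDimensional 𝕜 W] : LinearMap.adjoint (resOn 𝕜 S (c₀ := c₀) (W := W)) = extOn 𝕜 S := by
  rw [← adjoint_extOn, LinearMap.adjoint_adjoint]

/-- **`Ω₀` (extension by zero) is an isometry**: `‖Sg‖_{L²(T)} = ‖g‖_{L²(S)}`. [cite: Balaban1985BackgroundPropagators, p.394] -/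
theorem norm_extOn (g : L2On 𝕜 S c₀ W) : ‖extOn 𝕜 S g‖ = ‖g‖ := by
  rw [@norm_eq_sqrt_re_inner 𝕜, @norm_eq_sqrt_re_inner 𝕜, inner_extOn_left, resOn_extOn]

/-- `⟨f, Ω₀f′⟩ = ⟨f↾Ω₀, f′↾Ω₀⟩`: the characteristic function is a symmetric operator. [cite: Balaban1985BackgroundPropagators, p.394] -/
theorem inner_chiOn_right (f f' : WL2 𝕜 (fun _ : ι => c₀) W) : ⟪f, chiOn 𝕜 S f'⟫_𝕜 = ⟪resOn 𝕜 S f, resOn 𝕜 S f'⟫_𝕜 := by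
  rw [chiOn, LinearMap.comp_apply, ← inner_conj_symm, inner_extOn_left, inner_conj_symm]

/-- `Ω₀` is symmetric. [cite: Balaban1985BackgroundPropagators, p.394] -/
theorem chiOn_isSymmetric : (chiOn 𝕜 S (c₀ := c₀) (W := W)).IsSymmetric := by
  intro f f'
  rw [inner_chiOn_right, ← inner_conj_symm, inner_chiOn_right, inner_conj_symm]

end Restrict

/-! ## §4 The multiscale letters `Λ_j`, `𝔅 = ⋃_j Λ_j` on the tower and the STACKED averaging operators `Q` of (3.16), `Q′` of (3.18) -/

section Stack

variable (L : ℕ) (m : Fin d → ℕ) (k : ℕ)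

/-- **`𝔅 = ⋃_{j=0}^{k} Λ_j` FOR THE VECTOR FIELDS** — the index set of the constraints «(Q_j(U)A)(b), b ∈ Λ_j» of (3.16) / [4] (2.20): the
disjoint union over the levels `j = 0, …, k` of the finite sets `ΛB j` of bonds of the level-`(k−j)` torus `T^{(j)}_{Lʲη} = T_{L^{k−j} m}`
(LETTERS: print's `Λ_j = Ω_j^{(j)} ∖ Ω_{j+1}^{(j)}` read as sets of bonds of `T^{(j)}`; the cube geometry of [4] (2.1)–(2.4) is not modelled).
[cite: Balaban1985BackgroundPropagators, (3.16) p.393; Balaban1984PropagatorsII, (2.20) p.226] -/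
abbrev BIdx (ΛB : (j : Fin (k + 1)) → Finset (Bond d (towerP L m (k - j)))) : Type := Σ j : Fin (k + 1), ↥(ΛB j)

/-- **`𝔅 = ⋃_{j=0}^{k} Λ_j` FOR THE GAUGE PARAMETERS** — the index set of «(Q′λ)(y) = (Q′_j(U)λ)(y) for y ∈ Λ_j» (3.18): the disjoint
union of the finite sets `ΛS j` of sites of `T^{(j)}_{Lʲη}` (letters). [cite: Balaban1985BackgroundPropagators, (3.18) p.393, (3.24) p.394] -/
abbrev SIdx (ΛS : (j : Fin (k + 1)) → Finset (TSite d (towerP L m (k - j)))) : Type := Σ j : Fin (k + 1), ↥(ΛS j)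

variable (η : ℝ) (ΛB : (j : Fin (k + 1)) → Finset (Bond d (towerP L m (k - j))))
  (ΛS : (j : Fin (k + 1)) → Finset (TSite d (towerP L m (k - j))))

/-- **The level weight `(Lʲη)^{d−2}` of (3.16) on `𝔅`** (integer exponent `d − 2`; `Lʲη` = `LatticeNorms.scaleLen`; with the constant
`a` of (3.26) it is `B9Eq324LevelWeights.coeff316 a L η d j = a·(Lʲη)^{d−2}`, `wtB_mul_eq_coeff316`). [cite: Balaban1985BackgroundPropagators, (3.16) p.393] -/
def wtB : BIdx L m k ΛB → ℝ := fun x => scaleLen (L : ℝ) η x.1 ^ ((d : ℤ) - 2)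

/-- unfolding. [cite: Balaban1985BackgroundPropagators, (3.16) p.393] -/
theorem wtB_apply (x : BIdx L m k ΛB) : wtB L m k η ΛB x = scaleLen (L : ℝ) η x.1 ^ ((d : ℤ) - 2) := rfl

/-- `a · (Lʲη)^{d−2}` IS row B9.Eq3.16/3.24's printed coefficient `coeff316 a L η d j`. [cite: Balaban1985BackgroundPropagators, (3.16) p.393] -/
theorem wtB_mul_eq_coeff316 (a : ℝ) (x : BIdx L m k ΛB) : a * wtB L m k η ΛB x = coeff316 a (L : ℝ) η d x.1 := rfl

/-- The (3.16) weights are positive (`L ≧ 1`, `η > 0`), so `L²(𝔅)` below is an inner-product space.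
[cite: Balaban1985BackgroundPropagators, (3.16) p.393] -/
instance wtB_pos [NeZero L] [Fact (0 < η)] : Fact (∀ x : BIdx L m k ΛB, 0 < wtB L m k η ΛB x) :=
  ⟨fun _ => zpow_pos (scaleLen_pos (Nat.cast_pos.2 (NeZero.pos L)) (Fact.out : 0 < η) _) _⟩

variable {𝔸 : Type*} [NormedRing 𝔸] [NormedAlgebra ℂ 𝔸] [CompleteSpace 𝔸] [NormOneClass 𝔸]
  {W : Type*} [NormedAddCommGroup W] [InnerProductSpace ℂ W] (φ : W ≃ₗ[ℂ] 𝔸) {c₀ : ℝ}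

/-- Reading the family of level functions on `𝔅` («for b ∈ Λ_j», [4] (2.20)), values read on the Hilbert fibre along `φ`.
[cite: Balaban1984PropagatorsII, (2.20) p.226; Balaban1985BackgroundPropagators, (3.16) p.393] -/
def stackB : ((n : ℕ) → Bond d (towerP L m n) → 𝔸) →ₗ[ℂ] WL2 ℂ (wtB L m k η ΛB) W where
  toFun G := (WL2.equiv ℂ _ W).symm fun x => φ.symm (G (k - x.1) (x.2 : Bond d (towerP L m (k - x.1))))
  map_add' G G' := by funext x; exact map_add φ.symm _ _
  map_smul' c G := by funext x; exact LinearEquiv.map_smul φ.symm c _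

/-- Reading the family of level gauge parameters on `𝔅` («for y ∈ Λ_j», (3.18)). [cite: Balaban1985BackgroundPropagators, (3.18) p.393] -/
def stackS : ((n : ℕ) → TSite d (towerP L m n) → W) →ₗ[ℂ] (SIdx L m k ΛS → W) where
  toFun G := fun x => G (k - x.1) (x.2 : TSite d (towerP L m (k - x.1)))
  map_add' _ _ := rfl
  map_smul' _ _ := rfl

variable [NeZero L] (Rlev : (n : ℕ) → Bond d (towerP L m (n + 1)) → W →ₗ[ℂ] W)

/-- **THE STACKED `Q′ = Q′(U)` OF (3.18): `(Q′λ)(y) = (Q′_j(U)λ)(y)` for `y ∈ Λ_j`**, on the `L²` gauge parameters of the fine torus, at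
the level transporter data `Rlev` (print: `R(Ū^{·}(Γ_{y,x}))`). [cite: Balaban1985BackgroundPropagators, (3.18)–(3.19) p.393] -/
def QprimeStack : SiteL2K ℂ d (towerP L m k) c₀ W →ₗ[ℂ] (SIdx L m k ΛS → W) :=
  stackS L m k ΛS ∘ₗ QprimeLevels L m Rlev k ∘ₗ (WL2.linearEquiv ℂ ℂ (fun _ : TSite d (towerP L m k) => c₀)).toLinearMap

/-- Values: `(Q′λ)(j, y) = (Q′_j λ)(y)`. [cite: Balaban1985BackgroundPropagators, (3.18) p.393] -/
theorem QprimeStack_apply (l : SiteL2K ℂ d (towerP L m k) c₀ W) (x : SIdx L m k ΛS) :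
    QprimeStack L m k ΛS (c₀ := c₀) Rlev l x =
      QprimeLevels L m Rlev k (WL2.equiv ℂ _ W l) (k - x.1) (x.2 : TSite d (towerP L m (k - x.1))) := rfl

variable [∀ i, NeZero (m i)] (hL : 1 ≤ L)
  (Ulev : (n : ℕ) → Bond d (towerP L m (n + 1)) → 𝔸ˣ) (α : ℕ → ℝ) (hα1 : ∀ n, α n ≤ 1 / 64)
  (hU1 : ∀ (n : ℕ) (x : B7Prop1Explicit.Site d) (κ : Fin d), perCfg (towerP L m (n + 1)) (Ulev n) x κ ∈ U1 𝔸)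
  (hreg : ∀ (n : ℕ) (y : TSite d (towerP L m n)) (κ : Fin d) (r : Fin d → Fin L),
    ‖((Wcx L (perCfg (towerP L m (n + 1)) (Ulev n)) (cornerSite L y) κ (boxVec L r) : 𝔸ˣ) : 𝔸) - 1‖ ≤ α n)

/-- **THE STACKED AVERAGING `Q = Q(U)` OF (3.16) / [4] (2.20): `(QA)(b) = (Q_j(U)A)(b)` for `b ∈ Λ_j`**, from the `L²` bond functions of
the fine torus `T_η = T_{L^k m}` (weight `c₀ = η^d`, (3.11)) to `L²(𝔅)` with the level weights `(Lʲη)^{d−2}` — so that `Q†(aQ)` IS the operator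
`Q*aQ` «defined by the quadratic form (3.16)» (`inner_adjoint_Qstack`). [cite: Balaban1985BackgroundPropagators, (3.16) p.393; Balaban1984PropagatorsII, (2.20) p.226] -/
def Qstack : BondL2K ℂ d (towerP L m k) c₀ W →ₗ[ℂ] WL2 ℂ (wtB L m k η ΛB) W :=
  stackB L m k η ΛB φ ∘ₗ Qlevels L m hL Ulev α hα1 hU1 hreg k ∘ₗ φ.toLinearMap.compLeft (Bond d (towerP L m k)) ∘ₗ
    (WL2.linearEquiv ℂ ℂ (fun _ : Bond d (towerP L m k) => c₀)).toLinearMap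

/-- Values: `(QA)(j, b) = φ⁻¹((Q_j(U)(φ ∘ A))(b))` — the level-`j` average at `b ∈ Λ_j`. [cite: Balaban1985BackgroundPropagators, (3.16) p.393] -/
theorem Qstack_apply (A : BondL2K ℂ d (towerP L m k) c₀ W) (x : BIdx L m k ΛB) :
    WL2.equiv ℂ _ W (Qstack L m k η ΛB φ hL Ulev α hα1 hU1 hreg (c₀ := c₀) A) x =
      φ.symm (Qlevels L m hL Ulev α hα1 hU1 hreg k (fun b => φ (WL2.equiv ℂ _ W A b)) (k - x.1)
        (x.2 : Bond d (towerP L m (k - x.1)))) := rfl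

variable [Fact (0 < η)]

/-- **‖QA‖²_{L²(𝔅)} = Σ_{j=0}^{k} (Lʲη)^{d−2} Σ_{b∈Λ_j} |(Q_j(U)A)(b)|²** — the level sum of (3.16) without the constant `a`.
[cite: Balaban1985BackgroundPropagators, (3.16) p.393] -/
theorem norm_sq_Qstack (A : BondL2K ℂ d (towerP L m k) c₀ W) :
    ‖Qstack L m k η ΛB φ hL Ulev α hα1 hU1 hreg (c₀ := c₀) A‖ ^ 2 =
      ∑ j : Fin (k + 1), scaleLen (L : ℝ) η j ^ ((d : ℤ) - 2) *
        ∑ b ∈ ΛB j, ‖φ.symm (Qlevels L m hL Ulev α hα1 hU1 hreg k (fun b => φ (WL2.equiv ℂ _ W A b)) (k - j) b)‖ ^ 2 := by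
  rw [WL2.norm_sq, Fintype.sum_sigma]
  refine Finset.sum_congr rfl fun j _ => ?_
  rw [Finset.mul_sum, ← Finset.sum_attach (ΛB j)]
  exact Finset.sum_congr (Finset.univ_eq_attach _) fun b _ => rfl

variable [Fact (0 < c₀)] [FiniteDimensional ℂ W]

/-- **THE DISPLAY (3.16) FOR THE OPERATOR: `⟨A, Q*aQA⟩ = Σ_{j=0}^{k} a Σ_{b∈Λ_j} (Lʲη)^{d−2}|(Q_j(U)A)(b)|²`** — with `Q* = Q†` the Hilbert
adjoint of the stacked averaging for the pairing (3.11) `⟨A, A′⟩ = Σ_b η^d tr A(b)*A′(b)` (weight `c₀`) and the level-weighted `L²(𝔅)`,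
and `|·|` the Hilbert norm of the fibre read along `φ`: the operator `Q†(aQ)` IS print's `Q*aQ` «defined by the quadratic form».
[cite: Balaban1985BackgroundPropagators, (3.16) p.393, (3.11) p.392] -/
theorem inner_adjoint_Qstack (A : BondL2K ℂ d (towerP L m k) c₀ W) (a : ℝ) :
    ⟪A, LinearMap.adjoint (Qstack L m k η ΛB φ hL Ulev α hα1 hU1 hreg (c₀ := c₀))
        ((a : ℂ) • Qstack L m k η ΛB φ hL Ulev α hα1 hU1 hreg A)⟫_ℂ =
      ((a * ∑ j : Fin (k + 1), scaleLen (L : ℝ) η j ^ ((d : ℤ) - 2) *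
        ∑ b ∈ ΛB j, ‖φ.symm (Qlevels L m hL Ulev α hα1 hU1 hreg k (fun b => φ (WL2.equiv ℂ _ W A b)) (k - j) b)‖ ^ 2 : ℝ) : ℂ) := by
  rw [LinearMap.adjoint_inner_right, inner_smul_right, inner_self_eq_norm_sq_to_K, ← norm_sq_Qstack,
    RCLike.ofReal_eq_complex_ofReal]
  push_cast
  ring

end Stack

/-! ## §5 (3.21)–(3.27) AT ONE BACKGROUND: `R(U)` in `L²(Ω₀, 𝔤)`, `Δ_a(U)` of (3.26), `Δ_a↾Ω₀ = Ω₀Δ_aΩ₀`, `G(U) = (Δ_a↾Ω₀)⁻¹` of (3.27) -/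

section Assembly

variable {𝔸 : Type*} [NormedRing 𝔸] [NormedAlgebra ℂ 𝔸] [CompleteSpace 𝔸] [NormOneClass 𝔸]
  (L : ℕ) [NeZero L] (m : Fin d → ℕ) [∀ i, NeZero (m i)] (k : ℕ)
  {W : Type*} [NormedAddCommGroup W] [InnerProductSpace ℂ W] [FiniteDimensional ℂ W] (φ : W ≃ₗ[ℂ] 𝔸) {c₀ : ℝ} [Fact (0 < c₀)]
  (η : ℝ) (U : Bond d (towerP L m k) → 𝔸ˣ) (Ω₀ : Finset (TSite d (towerP L m k)))
  (ΛS : (j : Fin (k + 1)) → Finset (TSite d (towerP L m (k - j))))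
  (ΛB : (j : Fin (k + 1)) → Finset (Bond d (towerP L m (k - j))))

/-- **The bonds of `Ω₀`** (both endpoints in `Ω₀`): the carrier of the vector fields `A` under «Dirichlet boundary conditions on Ω₀ᶜ» — the
cell's convention `B9Eq323DirichletSplit.intBonds`. [cite: Balaban1985BackgroundPropagators, p.394, (3.27) p.395] -/
def bondsIn {P : Fin d → ℕ} (S : Finset (TSite d P)) : Finset (Bond d P) := Finset.univ.filter fun b => bpos b ∈ S ∧ btgt b ∈ S

omit [NeZero L] [∀ i, NeZero (m i)] in
/-- membership in `bondsIn`. [cite: Balaban1985BackgroundPropagators, p.394] -/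
theorem mem_bondsIn {P : Fin d → ℕ} (S : Finset (TSite d P)) (b : Bond d P) : b ∈ bondsIn S ↔ bpos b ∈ S ∧ btgt b ∈ S := by
  simp [bondsIn]

/-- **`Δ^η_U↾Ω₀ = Ω₀ D*_U D_U Ω₀`: «the covariant Laplace operator with Dirichlet boundary conditions on Ω₀ᶜ»** on `L²(Ω₀, 𝔤)` — (3.23)
`covLaplaceSiteK` at the transporters `R(U(b))`/`R(U(b)⁻¹)` and the scalar `η⁻¹`, sandwiched by the characteristic function of `Ω₀`.
[cite: Balaban1985BackgroundPropagators, (3.23) p.394 and the paragraph after (3.24)] -/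
def lapDir : L2On ℂ Ω₀ c₀ W →ₗ[ℂ] L2On ℂ Ω₀ c₀ W :=
  resOn ℂ Ω₀ ∘ₗ covLaplaceSiteK ((η : ℂ))⁻¹ (adTransportW φ U) (adTransportW φ fun b => (U b)⁻¹) ∘ₗ extOn ℂ Ω₀

/-- **`Q′` of (3.18) on `L²(Ω₀, 𝔤)`**: `λ ↦ ((Q′_j(U)(Ω₀λ))(y))_{y∈Λ_j, j ≦ k}` at print's transporters `R(Ū^{i}(b))` of the averaged
backgrounds (`B9Eq315QTower.UlevOf`, read on the fibre by `adTransportW`). [cite: Balaban1985BackgroundPropagators, (3.18)–(3.19) p.393] -/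
def QprimeDir : L2On ℂ Ω₀ c₀ W →ₗ[ℂ] (SIdx L m k ΛS → W) :=
  QprimeStack L m k ΛS (fun n => adTransportW φ (UlevOf L m k U n)) ∘ₗ extOn ℂ Ω₀

/-- **`R = R(U)` OF (3.21): «an orthogonal projection in the Hilbert space L²(Ω₀, 𝔤) onto the subspace ℛ = Δ^η_U N(Q′), N(Q′) = {λ : Q′λ = 0}»**
— `B11Eq103H1Complex.projR` at the Dirichlet Laplacian and the multi-level `Q′` on `L²(Ω₀, 𝔤)`.
[cite: Balaban1985BackgroundPropagators, (3.20)–(3.21) p.394] -/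
def Rdir : L2On ℂ Ω₀ c₀ W →ₗ[ℂ] L2On ℂ Ω₀ c₀ W := projR (lapDir L m k φ η U Ω₀) (QprimeDir L m k φ U Ω₀ ΛS)

omit [NormOneClass 𝔸] in
/-- `R` is symmetric («orthogonal projection»). [cite: Balaban1985BackgroundPropagators, (3.21) p.394] -/
theorem Rdir_isSymmetric : (Rdir L m k φ η U Ω₀ ΛS (c₀ := c₀)).IsSymmetric := projR_isSymmetric _ _

omit [NormOneClass 𝔸] in
/-- `R² = R`. [cite: Balaban1985BackgroundPropagators, (3.21) p.394] -/
theorem Rdir_Rdir (f : L2On ℂ Ω₀ c₀ W) : Rdir L m k φ η U Ω₀ ΛS (Rdir L m k φ η U Ω₀ ΛS f) = Rdir L m k φ η U Ω₀ ΛS f :=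
  projR_projR _ _ f

omit [NormOneClass 𝔸] in
/-- **(3.22): `Rf = Δ^η_U↾Ω₀ λ₀` with `Q′λ₀ = 0`.** [cite: Balaban1985BackgroundPropagators, (3.22) p.394] -/
theorem exists_ker_Rdir_eq (f : L2On ℂ Ω₀ c₀ W) :
    ∃ l : L2On ℂ Ω₀ c₀ W, QprimeDir L m k φ U Ω₀ ΛS l = 0 ∧ Rdir L m k φ η U Ω₀ ΛS f = lapDir L m k φ η U Ω₀ l :=
  exists_ker_projR_eq _ _ f

/-- **`R(U)` read on `L²(T_η, 𝔤)` through «Ω₀ = characteristic function»: `Ω₀ R Ω₀`** (restrict, project, extend by zero) — the `Rr`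
slot of (3.26) («All operators we will consider will be defined by using Dirichlet boundary conditions on Ω₀ … we do not indicate this
fact in our notations», p. 394). [cite: Balaban1985BackgroundPropagators, (3.21) p.394, (3.26) p.395] -/
def Rtorus : SiteL2K ℂ d (towerP L m k) c₀ W →ₗ[ℂ] SiteL2K ℂ d (towerP L m k) c₀ W :=
  extOn ℂ Ω₀ ∘ₗ Rdir L m k φ η U Ω₀ ΛS ∘ₗ resOn ℂ Ω₀

omit [NormOneClass 𝔸] in
/-- `Ω₀ R Ω₀` is symmetric. [cite: Balaban1985BackgroundPropagators, (3.21) p.394] -/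
theorem Rtorus_isSymmetric : (Rtorus L m k φ η U Ω₀ ΛS (c₀ := c₀)).IsSymmetric := by
  intro f g
  simp only [Rtorus, LinearMap.comp_apply]
  rw [inner_extOn_left, Rdir_isSymmetric L m k φ η U Ω₀ ΛS (resOn ℂ Ω₀ f) (resOn ℂ Ω₀ g), ← inner_conj_symm f,
    inner_extOn_left, inner_conj_symm]

variable [StarRing 𝔸] [StarModule ℂ 𝔸] (τ : 𝔸 →ₗ[ℂ] ℂ) [Fact (0 < η)] (hL : 1 ≤ L) (α : ℕ → ℝ) (hα1 : ∀ n, α n ≤ 1 / 64)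
  (hU1 : ∀ (n : ℕ) (x : B7Prop1Explicit.Site d) (κ : Fin d), perCfg (towerP L m (n + 1)) (UlevOf L m k U n) x κ ∈ U1 𝔸)
  (hreg : ∀ (n : ℕ) (y : TSite d (towerP L m n)) (κ : Fin d) (r : Fin d → Fin L),
    ‖((Wcx L (perCfg (towerP L m (n + 1)) (UlevOf L m k U n)) (cornerSite L y) κ (boxVec L r) : 𝔸ˣ) : 𝔸) - 1‖ ≤ α n)

/-- **`Q*(U)aQ(U)` — the operator «defined by the quadratic form (3.16)»**: `Q†(aQ)` for the stacked averaging `Q(U)` at print's own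
composites `Q_j(U) = Q(Ū^{j−1})⋯Q(U)` (family `UlevOf`) and the level-weighted `L²(𝔅)`. [cite: Balaban1985BackgroundPropagators, (3.16) p.393, (3.26) p.395] -/
def QaQ (a : ℝ) : BondL2K ℂ d (towerP L m k) c₀ W →ₗ[ℂ] BondL2K ℂ d (towerP L m k) c₀ W :=
  LinearMap.adjoint (Qstack L m k η ΛB φ hL (UlevOf L m k U) α hα1 hU1 hreg (c₀ := c₀)) ∘ₗ
    ((a : ℂ) • Qstack L m k η ΛB φ hL (UlevOf L m k U) α hα1 hU1 hreg)

omit [StarRing 𝔸] [StarModule ℂ 𝔸] in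
/-- **(3.16) for `Q*(U)aQ(U)`: `⟨A, Q*aQA⟩ = Σ_{j=0}^{k} a Σ_{b∈Λ_j} (Lʲη)^{d−2}|(Q_j(U)A)(b)|²`** at print's composites.
[cite: Balaban1985BackgroundPropagators, (3.16) p.393] -/
theorem inner_QaQ (a : ℝ) (A : BondL2K ℂ d (towerP L m k) c₀ W) :
    ⟪A, QaQ L m k φ η U ΛB hL α hα1 hU1 hreg (c₀ := c₀) a A⟫_ℂ =
      ((a * ∑ j : Fin (k + 1), scaleLen (L : ℝ) η j ^ ((d : ℤ) - 2) *
        ∑ b ∈ ΛB j, ‖φ.symm (Qlevels L m hL (UlevOf L m k U) α hα1 hU1 hreg k (fun b => φ (WL2.equiv ℂ _ W A b)) (k - j) b)‖ ^ 2 :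
          ℝ) : ℂ) :=
  inner_adjoint_Qstack L m k η ΛB φ hL (UlevOf L m k U) α hα1 hU1 hreg A a

/-- **(3.26): `Δ_a(U) = Δ(U) + D_U R(U) D*_U + Q*(U)aQ(U)`** on the `L²` bond functions of the fine torus `T_η = T_{L^k m}` — `Δ(U)` the
Hessian (3.10) (`B9Eq310HessianOperator.hessOp`), `D_U`/`D*_U` of (3.3)/(3.8) at the transporters `R(U(b))`/`R(U(b)⁻¹)` and `η⁻¹`, `R(U)` the
Dirichlet projection of (3.21) read through `Ω₀`, and print's multi-level `Q*(U)aQ(U)` of (3.16): `B11Eq103H1Complex.laplaceALatticeK` at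
these letters. [cite: Balaban1985BackgroundPropagators, (3.26) p.395] -/
def laplaceA (a : ℝ) : BondL2K ℂ d (towerP L m k) c₀ W →ₗ[ℂ] BondL2K ℂ d (towerP L m k) c₀ W :=
  laplaceALatticeK ((η : ℂ))⁻¹ (adTransportW φ U) (adTransportW φ fun b => (U b)⁻¹) (hessOp φ η U τ) (Rtorus L m k φ η U Ω₀ ΛS)
    (Qstack L m k η ΛB φ hL (UlevOf L m k U) α hα1 hU1 hreg (c₀ := c₀)) a

/-- **«or simply Δ_a = Δ + DRD* + Q*aQ»**: the three summands by name (`D` = `covDerivL2K`, `D*` = `covDivL2K`).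
[cite: Balaban1985BackgroundPropagators, (3.26) p.395] -/
theorem laplaceA_eq (a : ℝ) :
    laplaceA L m k φ η U Ω₀ ΛS ΛB τ hL α hα1 hU1 hreg (c₀ := c₀) a =
      hessOp φ η U τ +
        B11Eq103H1Complex.covDerivL2K ℂ c₀ ((η : ℂ))⁻¹ (adTransportW φ U) ∘ₗ Rtorus L m k φ η U Ω₀ ΛS ∘ₗ
          B11Eq103H1Complex.covDivL2K ℂ c₀ ((η : ℂ))⁻¹ (adTransportW φ fun b => (U b)⁻¹) +
        QaQ L m k φ η U ΛB hL α hα1 hU1 hreg (c₀ := c₀) a :=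
  rfl

/-- **`Δ_a(U)` IS SYMMETRIC** for a unitary background, a `*`-trace and the compatibility of the two normings ([B7] (18)) — print's «hermitian»
((3.10)) for the whole of (3.26) (`R` symmetric by construction, `Q*aQ = Q†aQ`). [cite: Balaban1985BackgroundPropagators, (3.26) p.395, (3.10) p.392] -/
theorem laplaceA_isSymmetric (hU : ∀ b, star (U b : 𝔸) = ((U b)⁻¹ : 𝔸ˣ)) (hτ₁ : ∀ X : 𝔸, τ (star X) = conj (τ X))
    (hτ₂ : ∀ X Y : 𝔸, τ (X * Y) = τ (Y * X)) (hφ : ∀ X Y : 𝔸, ⟪φ.symm X, φ.symm Y⟫_ℂ = τ (star X * Y)) (a : ℝ) :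
    (laplaceA L m k φ η U Ω₀ ΛS ΛB τ hL α hα1 hU1 hreg (c₀ := c₀) a).IsSymmetric :=
  laplaceALatticeK_isSymmetric (by rw [map_inv₀, Complex.conj_ofReal]) (adTransportW_adjoint φ τ hτ₂ hU hφ)
    (hessOp_isSymmetric_of_trace φ τ hτ₁ hτ₂ η hU hφ) (Rtorus_isSymmetric L m k φ η U Ω₀ ΛS)

/-- **`Δ_a↾Ω₀ = Ω₀Δ_aΩ₀` — «Δ_a with Dirichlet boundary conditions on Ω₀ᶜ»** as an operator on `L²` of the bonds of `Ω₀`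
(restrict ∘ Δ_a ∘ extend by zero). [cite: Balaban1985BackgroundPropagators, (3.27) p.395] -/
def laplaceADir (a : ℝ) : L2On ℂ (bondsIn Ω₀) c₀ W →ₗ[ℂ] L2On ℂ (bondsIn Ω₀) c₀ W :=
  resOn ℂ (bondsIn Ω₀) ∘ₗ laplaceA L m k φ η U Ω₀ ΛS ΛB τ hL α hα1 hU1 hreg a ∘ₗ extOn ℂ (bondsIn Ω₀)

/-- **LITERALLY «Ω₀Δ_aΩ₀»** on `L²(T_η, 𝔤)`: extending `Δ_a↾Ω₀` by zero gives the sandwich of `Δ_a` by the characteristic function of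
(the bonds of) `Ω₀`. [cite: Balaban1985BackgroundPropagators, (3.27) p.395] -/
theorem extOn_laplaceADir_resOn (a : ℝ) :
    extOn ℂ (bondsIn Ω₀) ∘ₗ laplaceADir L m k φ η U Ω₀ ΛS ΛB τ hL α hα1 hU1 hreg (c₀ := c₀) (W := W) a ∘ₗ resOn ℂ (bondsIn Ω₀) =
      chiOn ℂ (bondsIn Ω₀) ∘ₗ laplaceA L m k φ η U Ω₀ ΛS ΛB τ hL α hα1 hU1 hreg a ∘ₗ chiOn ℂ (bondsIn Ω₀) :=
  rfl

/-- `Δ_a↾Ω₀` is symmetric when `Δ_a` is. [cite: Balaban1985BackgroundPropagators, (3.27) p.395] -/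
theorem laplaceADir_isSymmetric {a : ℝ} (h : (laplaceA L m k φ η U Ω₀ ΛS ΛB τ hL α hα1 hU1 hreg (c₀ := c₀) a).IsSymmetric) :
    (laplaceADir L m k φ η U Ω₀ ΛS ΛB τ hL α hα1 hU1 hreg (c₀ := c₀) a).IsSymmetric := by
  intro f g
  simp only [laplaceADir, LinearMap.comp_apply]
  rw [← inner_conj_symm, ← inner_extOn_left, inner_conj_symm, h, inner_extOn_left]

variable {a : ℝ}
  (hpos : ∀ x : L2On ℂ (bondsIn Ω₀) c₀ W, x ≠ 0 →
    0 < RCLike.re ⟪x, laplaceADir L m k φ η U Ω₀ ΛS ΛB τ hL α hα1 hU1 hreg (c₀ := c₀) a x⟫_ℂ)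

/-- **(3.27): `G(U) = G = (Δ_a↾Ω₀)⁻¹`** — «we denote its inverse again by G, or G(U)»: the inverse operator on `L²` of the bonds of `Ω₀`,
CONSTRUCTED from the positivity of `Δ_a↾Ω₀` (Theorem 3.11 «Δ_a, G are positive definite», displayed as the hypothesis `hpos`).
[cite: Balaban1985BackgroundPropagators, (3.27) p.395, Thm 3.11 p.416] -/
def G : L2On ℂ (bondsIn Ω₀) c₀ W →ₗ[ℂ] L2On ℂ (bondsIn Ω₀) c₀ W :=
  greenK (laplaceADir L m k φ η U Ω₀ ΛS ΛB τ hL α hα1 hU1 hreg a) hpos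

/-- `(Δ_a↾Ω₀) ∘ G = 1`. [cite: Balaban1985BackgroundPropagators, (3.27) p.395] -/
@[simp] theorem laplaceADir_G (x : L2On ℂ (bondsIn Ω₀) c₀ W) :
    laplaceADir L m k φ η U Ω₀ ΛS ΛB τ hL α hα1 hU1 hreg a (G L m k φ η U Ω₀ ΛS ΛB τ hL α hα1 hU1 hreg hpos x) = x :=
  apply_greenK hpos x

/-- `G ∘ (Δ_a↾Ω₀) = 1`. [cite: Balaban1985BackgroundPropagators, (3.27) p.395] -/
@[simp] theorem G_laplaceADir (x : L2On ℂ (bondsIn Ω₀) c₀ W) :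
    G L m k φ η U Ω₀ ΛS ΛB τ hL α hα1 hU1 hreg hpos (laplaceADir L m k φ η U Ω₀ ΛS ΛB τ hL α hα1 hU1 hreg a x) = x :=
  greenK_apply hpos x

/-- `G` is symmetric when `Δ_a↾Ω₀` is (the inverse of a symmetric bijection). [cite: Balaban1985BackgroundPropagators, (3.27) p.395, Thm 3.11 p.416] -/
theorem G_isSymmetric (h : (laplaceADir L m k φ η U Ω₀ ΛS ΛB τ hL α hα1 hU1 hreg (c₀ := c₀) a).IsSymmetric) :
    (G L m k φ η U Ω₀ ΛS ΛB τ hL α hα1 hU1 hreg hpos).IsSymmetric := by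
  intro x y
  conv_lhs => rw [← laplaceADir_G L m k φ η U Ω₀ ΛS ΛB τ hL α hα1 hU1 hreg hpos y]
  rw [← h, laplaceADir_G]

/-- **`G(U)` read on `L²(T_η, 𝔤)`: `Ω₀ G Ω₀`** (zero off the bonds of `Ω₀` — «we do not indicate this fact in our notations»).
[cite: Balaban1985BackgroundPropagators, (3.27) p.395, p.394] -/
def Gtorus : BondL2K ℂ d (towerP L m k) c₀ W →ₗ[ℂ] BondL2K ℂ d (towerP L m k) c₀ W :=
  extOn ℂ (bondsIn Ω₀) ∘ₗ G L m k φ η U Ω₀ ΛS ΛB τ hL α hα1 hU1 hreg hpos ∘ₗ resOn ℂ (bondsIn Ω₀)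

/-- **`(Ω₀GΩ₀)(Ω₀Δ_aΩ₀) = Ω₀`**: on `L²(T_η, 𝔤)` the extended inverse inverts the Dirichlet operator on the functions supported in `Ω₀`.
[cite: Balaban1985BackgroundPropagators, (3.27) p.395] -/
theorem Gtorus_comp_dirichlet :
    Gtorus L m k φ η U Ω₀ ΛS ΛB τ hL α hα1 hU1 hreg hpos ∘ₗ
        (chiOn ℂ (bondsIn Ω₀) ∘ₗ laplaceA L m k φ η U Ω₀ ΛS ΛB τ hL α hα1 hU1 hreg a ∘ₗ chiOn ℂ (bondsIn Ω₀)) =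
      chiOn ℂ (bondsIn Ω₀) := by
  apply LinearMap.ext
  intro A
  simp only [Gtorus, chiOn, LinearMap.comp_apply, resOn_extOn]
  exact congrArg (extOn ℂ (bondsIn Ω₀)) (G_laplaceADir L m k φ η U Ω₀ ΛS ΛB τ hL α hα1 hU1 hreg hpos (resOn ℂ (bondsIn Ω₀) A))

/-- **`(Ω₀Δ_aΩ₀)(Ω₀GΩ₀) = Ω₀`.** [cite: Balaban1985BackgroundPropagators, (3.27) p.395] -/
theorem dirichlet_comp_Gtorus :
    (chiOn ℂ (bondsIn Ω₀) ∘ₗ laplaceA L m k φ η U Ω₀ ΛS ΛB τ hL α hα1 hU1 hreg a ∘ₗ chiOn ℂ (bondsIn Ω₀)) ∘ₗ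
        Gtorus L m k φ η U Ω₀ ΛS ΛB τ hL α hα1 hU1 hreg hpos =
      chiOn ℂ (bondsIn Ω₀) := by
  apply LinearMap.ext
  intro A
  simp only [Gtorus, chiOn, LinearMap.comp_apply, resOn_extOn]
  exact congrArg (extOn ℂ (bondsIn Ω₀)) (laplaceADir_G L m k φ η U Ω₀ ΛS ΛB τ hL α hα1 hU1 hreg hpos (resOn ℂ (bondsIn Ω₀) A))

end Assembly

/-! ## §6 The quadratic form of (3.26) term by term — `⟨A, Δ_aA⟩ = ⟨A, Δ(U)A⟩ + ‖R(D*_UA↾Ω₀)‖² + ⟨A, Q*aQA⟩` — and the uniqueness of `G` -/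

section Form

variable {𝔸 : Type*} [NormedRing 𝔸] [NormedAlgebra ℂ 𝔸] [CompleteSpace 𝔸] [NormOneClass 𝔸]
  (L : ℕ) [NeZero L] (m : Fin d → ℕ) [∀ i, NeZero (m i)] (k : ℕ)
  {W : Type*} [NormedAddCommGroup W] [InnerProductSpace ℂ W] [FiniteDimensional ℂ W] (φ : W ≃ₗ[ℂ] 𝔸) {c₀ : ℝ} [Fact (0 < c₀)]
  (η : ℝ) (U : Bond d (towerP L m k) → 𝔸ˣ) (Ω₀ : Finset (TSite d (towerP L m k)))
  (ΛS : (j : Fin (k + 1)) → Finset (TSite d (towerP L m (k - j))))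
  (ΛB : (j : Fin (k + 1)) → Finset (Bond d (towerP L m (k - j))))

omit [NormOneClass 𝔸] in
/-- `⟨f, Rf⟩ = ‖Rf‖²` for the orthogonal projection `R` of (3.21) (symmetric and idempotent). [cite: Balaban1985BackgroundPropagators, (3.21) p.394] -/
theorem inner_Rdir_self (f : L2On ℂ Ω₀ c₀ W) :
    ⟪f, Rdir L m k φ η U Ω₀ ΛS f⟫_ℂ = ((‖Rdir L m k φ η U Ω₀ ΛS f‖ ^ 2 : ℝ) : ℂ) := by
  rw [← Rdir_Rdir L m k φ η U Ω₀ ΛS f, ← Rdir_isSymmetric L m k φ η U Ω₀ ΛS f, Rdir_Rdir, inner_self_eq_norm_sq_to_K,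
    RCLike.ofReal_eq_complex_ofReal]
  push_cast
  ring

variable [StarRing 𝔸] [StarModule ℂ 𝔸] (τ : 𝔸 →ₗ[ℂ] ℂ)

omit [NormOneClass 𝔸] [StarModule ℂ 𝔸] in
/-- **THE GAUGE-FIXING TERM OF (3.26) IS THE EXPONENT OF (3.20)**: `⟨A, D_U(Ω₀RΩ₀)D*_UA⟩ = ‖R((D*_UA)↾Ω₀)‖²` — for a unitary background and a
`*`-trace compatible with the Hilbert norming ([B7] (18)), so that `D*_U = D_U†` ((3.8), `B11Eq103H1Complex.adjoint_covDerivL2K`); print (3.17)/(3.20):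
«(3.17) = exp(−½‖RD*A‖²)». [cite: Balaban1985BackgroundPropagators, (3.20) p.394, (3.26) p.395, (3.8) p.392] -/
theorem inner_DRD (hU : ∀ b, star (U b : 𝔸) = ((U b)⁻¹ : 𝔸ˣ)) (hτ₂ : ∀ X Y : 𝔸, τ (X * Y) = τ (Y * X))
    (hφ : ∀ X Y : 𝔸, ⟪φ.symm X, φ.symm Y⟫_ℂ = τ (star X * Y)) (A : BondL2K ℂ d (towerP L m k) c₀ W) :
    ⟪A, B11Eq103H1Complex.covDerivL2K ℂ c₀ ((η : ℂ))⁻¹ (adTransportW φ U)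
        (Rtorus L m k φ η U Ω₀ ΛS (B11Eq103H1Complex.covDivL2K ℂ c₀ ((η : ℂ))⁻¹ (adTransportW φ fun b => (U b)⁻¹) A))⟫_ℂ =
      ((‖Rdir L m k φ η U Ω₀ ΛS
          (resOn ℂ Ω₀ (B11Eq103H1Complex.covDivL2K ℂ c₀ ((η : ℂ))⁻¹ (adTransportW φ fun b => (U b)⁻¹) A))‖ ^ 2 : ℝ) : ℂ) := by
  have hadj := B11Eq103H1Complex.adjoint_covDerivL2K (c₀ := c₀) ((η : ℂ))⁻¹ (by rw [map_inv₀, Complex.conj_ofReal])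
    (adTransportW φ U) (adTransportW φ fun b => (U b)⁻¹) (adTransportW_adjoint φ τ hτ₂ hU hφ)
  rw [← LinearMap.adjoint_inner_left, hadj, Rtorus, LinearMap.comp_apply, LinearMap.comp_apply, ← inner_conj_symm, inner_extOn_left,
    inner_conj_symm, inner_Rdir_self]

variable [Fact (0 < η)] (hL : 1 ≤ L) (α : ℕ → ℝ) (hα1 : ∀ n, α n ≤ 1 / 64)
  (hU1 : ∀ (n : ℕ) (x : B7Prop1Explicit.Site d) (κ : Fin d), perCfg (towerP L m (n + 1)) (UlevOf L m k U n) x κ ∈ U1 𝔸)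
  (hreg : ∀ (n : ℕ) (y : TSite d (towerP L m n)) (κ : Fin d) (r : Fin d → Fin L),
    ‖((Wcx L (perCfg (towerP L m (n + 1)) (UlevOf L m k U n)) (cornerSite L y) κ (boxVec L r) : 𝔸ˣ) : 𝔸) - 1‖ ≤ α n)

omit [StarRing 𝔸] [StarModule ℂ 𝔸] in
/-- `⟨A, Q*aQA⟩ = a‖QA‖²_{L²(𝔅)}` (the level sum of (3.16) is `norm_sq_Qstack`). [cite: Balaban1985BackgroundPropagators, (3.16) p.393] -/
theorem inner_QaQ_eq_norm_sq (a : ℝ) (A : BondL2K ℂ d (towerP L m k) c₀ W) :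
    ⟪A, QaQ L m k φ η U ΛB hL α hα1 hU1 hreg (c₀ := c₀) a A⟫_ℂ =
      ((a * ‖Qstack L m k η ΛB φ hL (UlevOf L m k U) α hα1 hU1 hreg A‖ ^ 2 : ℝ) : ℂ) := by
  rw [QaQ, LinearMap.comp_apply, LinearMap.smul_apply, LinearMap.adjoint_inner_right, inner_smul_right, inner_self_eq_norm_sq_to_K,
    RCLike.ofReal_eq_complex_ofReal]
  push_cast
  ring

/-- **THE QUADRATIC FORM OF (3.26), TERM BY TERM**: `⟨A, Δ_a(U)A⟩ = ⟨A, Δ(U)A⟩ + ‖R((D*_UA)↾Ω₀)‖² + a‖Q(U)A‖²_{L²(𝔅)}` (unitary background,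
`*`-trace, compatible normings) — the Hessian (3.12), the gauge-fixing exponent (3.20) and the averaging form (3.16): the three quadratic forms
print adds up to define `Δ_a`. [cite: Balaban1985BackgroundPropagators, (3.26) p.395, (3.20) p.394, (3.16) p.393, (3.12) p.392] -/
theorem inner_laplaceA (hU : ∀ b, star (U b : 𝔸) = ((U b)⁻¹ : 𝔸ˣ)) (hτ₂ : ∀ X Y : 𝔸, τ (X * Y) = τ (Y * X))
    (hφ : ∀ X Y : 𝔸, ⟪φ.symm X, φ.symm Y⟫_ℂ = τ (star X * Y)) (a : ℝ) (A : BondL2K ℂ d (towerP L m k) c₀ W) :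
    ⟪A, laplaceA L m k φ η U Ω₀ ΛS ΛB τ hL α hα1 hU1 hreg a A⟫_ℂ =
      ⟪A, hessOp φ η U τ A⟫_ℂ +
        ((‖Rdir L m k φ η U Ω₀ ΛS
            (resOn ℂ Ω₀ (B11Eq103H1Complex.covDivL2K ℂ c₀ ((η : ℂ))⁻¹ (adTransportW φ fun b => (U b)⁻¹) A))‖ ^ 2 : ℝ) : ℂ) +
        ((a * ‖Qstack L m k η ΛB φ hL (UlevOf L m k U) α hα1 hU1 hreg A‖ ^ 2 : ℝ) : ℂ) := by
  rw [laplaceA_eq, LinearMap.add_apply, LinearMap.add_apply, inner_add_right, inner_add_right, LinearMap.comp_apply, LinearMap.comp_apply,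
    inner_DRD L m k φ η U Ω₀ ΛS τ hU hτ₂ hφ, inner_QaQ_eq_norm_sq]

/-- Hence **`re⟨A, Δ_a(U)A⟩ = re⟨A, Δ(U)A⟩ + ‖R((D*_UA)↾Ω₀)‖² + a‖Q(U)A‖²`** (real parts; the positivity statement of Theorem 3.11 concerns the
left side). [cite: Balaban1985BackgroundPropagators, (3.26) p.395, Thm 3.11 p.416] -/
theorem re_inner_laplaceA (hU : ∀ b, star (U b : 𝔸) = ((U b)⁻¹ : 𝔸ˣ)) (hτ₂ : ∀ X Y : 𝔸, τ (X * Y) = τ (Y * X))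
    (hφ : ∀ X Y : 𝔸, ⟪φ.symm X, φ.symm Y⟫_ℂ = τ (star X * Y)) (a : ℝ) (A : BondL2K ℂ d (towerP L m k) c₀ W) :
    RCLike.re ⟪A, laplaceA L m k φ η U Ω₀ ΛS ΛB τ hL α hα1 hU1 hreg a A⟫_ℂ =
      RCLike.re ⟪A, hessOp φ η U τ A⟫_ℂ +
        ‖Rdir L m k φ η U Ω₀ ΛS (resOn ℂ Ω₀ (B11Eq103H1Complex.covDivL2K ℂ c₀ ((η : ℂ))⁻¹ (adTransportW φ fun b => (U b)⁻¹) A))‖ ^ 2 +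
        a * ‖Qstack L m k η ΛB φ hL (UlevOf L m k U) α hα1 hU1 hreg A‖ ^ 2 := by
  rw [inner_laplaceA L m k φ η U Ω₀ ΛS ΛB τ hL α hα1 hU1 hreg hU hτ₂ hφ a A]
  simp only [map_add, RCLike.re_to_complex, Complex.ofReal_re]

variable {a : ℝ}
  (hpos : ∀ x : L2On ℂ (bondsIn Ω₀) c₀ W, x ≠ 0 →
    0 < RCLike.re ⟪x, laplaceADir L m k φ η U Ω₀ ΛS ΛB τ hL α hα1 hU1 hreg (c₀ := c₀) a x⟫_ℂ)

/-- **«its inverse» is unique**: any right inverse of `Δ_a↾Ω₀` is `G`. [cite: Balaban1985BackgroundPropagators, (3.27) p.395] -/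
theorem eq_G_of_rightInverse (g : L2On ℂ (bondsIn Ω₀) c₀ W →ₗ[ℂ] L2On ℂ (bondsIn Ω₀) c₀ W)
    (hg : ∀ x, laplaceADir L m k φ η U Ω₀ ΛS ΛB τ hL α hα1 hU1 hreg a (g x) = x) :
    g = G L m k φ η U Ω₀ ΛS ΛB τ hL α hα1 hU1 hreg hpos := by
  apply LinearMap.ext
  intro x
  apply B11Eq103H1Complex.injective_of_rePosDef hpos
  rw [hg, laplaceADir_G]

/-- … and so is any left inverse. [cite: Balaban1985BackgroundPropagators, (3.27) p.395] -/
theorem eq_G_of_leftInverse (g : L2On ℂ (bondsIn Ω₀) c₀ W →ₗ[ℂ] L2On ℂ (bondsIn Ω₀) c₀ W)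
    (hg : ∀ x, g (laplaceADir L m k φ η U Ω₀ ΛS ΛB τ hL α hα1 hU1 hreg a x) = x) :
    g = G L m k φ η U Ω₀ ΛS ΛB τ hL α hα1 hU1 hreg hpos := by
  apply LinearMap.ext
  intro x
  conv_lhs => rw [← laplaceADir_G L m k φ η U Ω₀ ΛS ΛB τ hL α hα1 hU1 hreg hpos x]
  rw [hg]

end Form

end Literature.MathematicalPhysics.QuantumFieldTheory.Balaban1983to89.B9Eq326MultiLevelAssembly

end
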